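import Mathlib
import HarnessLib
import Summits.CriticalPhenomena.CardyFormulaZ2.Theses.CardyMagicRigidity
import Summits.CriticalPhenomena.CardyFormulaZ2.Theorems.CardyMagicRigidityTransferContinuityReduction
import Summits.CriticalPhenomena.CardyFormulaZ2.Theorems.CardyMagicRigidityMagicFormulaTSmearedCentring
import Summits.CriticalPhenomena.CardyFormulaZ2.Theorems.CardyMagicRigidityMagicFormulaTExistenceIdentification
import Summits.CriticalPhenomena.CardyFormulaZ2.Theorems.CardyMagicRigidityMagicFormulaTStubEntire
import Summits.CriticalPhenomena.CardyFormulaZ2.Theorems.CardyMagicRigidityMagicFormulaTStubNormalFamily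
import Summits.CriticalPhenomena.CardyFormulaZ2.Theorems.CardyMagicRigidityMagicFormulaTStubTaylorLimit
import Summits.CriticalPhenomena.CardyFormulaZ2.Theorems.CardyMagicRigidityMagicFormulaTStubVitaliCoeff
import Summits.CriticalPhenomena.CardyFormulaZ2.Theorems.CardyMagicRigidityMagicFormulaTSecondOrderReduction
import Summits.CriticalPhenomena.CardyFormulaZ2.Theorems.CardyMagicRigidityMagicFormulaTThirdOrderReduction
import Summits.CriticalPhenomena.CardyFormulaZ2.Theorems.CardyMagicRigidityMagicFormulaTCoefficientResidue
import Literature.Probability.RandomPlanarGeometry.NestingTransform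
import Literature.Probability.Percolation.FullPlaneCNL
import Literature.Probability.Percolation.TriCorrLengthExponentDecomposition

/-!
# Crux `MagicFormulaT` — the route-level SPLIT glue `MagicFormulaT_of_subs` (strategist s4)

Crux `Summit.CriticalPhenomena.CardyFormulaZ2.Theses.CardyMagicRigidity.MagicFormulaT`
(stmt-CriticalPhenomena-4836, route `CardyMagicRigidity`, rank 4): for every admissible density `f`
(measurable, `|f| ≤ C`, `f = 0` off `‖z‖ ≤ R`, `∫ f = 0`) the site-`𝕋` twisted nesting transform
`Λ^𝕋_δ(f) = E_{1/2}[∏_u 2cos(θ_u(f) + π/3)]`, `θ_u(f) = ∫_{W(u,·)≠0} f`, over all honeycomb interface loops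
`u` of `δ𝕋`, tends to `G(f) = exp(q(f))`, `q(f) = (3/4π²) ∬ log‖x−y‖ f(x) f(y)`, as `δ → 0⁺`.

This file PROVES, sorry-free and without any named fact, the implication

  `TwoPointT → ThreePointT → FourUpT → MagicFormulaT`     (`MagicFormulaT_of_subs`)

whose three hypotheses are the statements of the three sub-cruxes of the route-level split of `MagicFormulaT`
(written in the ROUTE's own vocabulary — the untyped set of honeycomb interface loops of the crux and
`∫ z in {z | u.wind z ≠ 0}, f z` for the nesting phase — so that the gate can render them in
`Theses/CardyMagicRigidity.lean` without new imports):

* `TwoPointT` — ORDER 2 (Schramm–Sheffield–Wilson / Miller–Watson–Wilson level): `E_{1/2}[3A₁² − 4A₂] →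
  (3/2π²) ∬ f f log‖x−y‖`, `A_m = Σ_u θ_u^m` (honest finite sums at fixed mesh).
* `ThreePointT` — ORDER 3, the first open order (evenness, Disproof F5): `E_{1/2}[3A₁³ − 12A₁A₂ + 8A₃] → 0`.
* `FourUpT` — ORDERS `≥ 4`, the open core ("bosonisation of full-plane CLE₆ is exact", graded): with
  `Φ_δ(t) := E_{1/2}[∏_u 2cos(t·θ_u(f) + π/3)]` (entire in `t ∈ ℂ` at every mesh `δ > 0`, `stub_entire`), for every
  `k ≥ 4` the Taylor coefficient `Φ_δ^{(k)}(0)` CONVERGES, as `δ → 0⁺`, to the `k`-th Taylor coefficient at `0` of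
  `G_f(t) = exp(q(f) t²)` (odd `k`: `0`; `k = 2m`: `(2m)!/m! · q(f)^m`).  Outright-convergence form = the skeleton's
  `stub_fourUp` (identification of the limit) + existence of the coefficient limits, which is settled modulo the two
  published inputs `exists_isFullPlaneCNLLaw` (Camia–Newman 2006) and `SmirnovWerner2001_fourArm_scalingLimit`
  (Smirnov–Werner 2001): `coeffLimitsExistT_of_facts` and `fourUpT_of_facts_of_identification` below.

`TwoPointT` / `ThreePointT` are literally the stubs `stub_twoPoint` / `stub_threePoint` of the registered skeleton
`Cruxes/MagicFormulaT/Lines/Sketch.lean` v9 (lead c4) modulo `loops_siteLoopConfig` and the definition of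
`UnbasedLoop.nestingPhase`; the proof of the glue is the skeleton's composition `MagicFormulaT_of` with the stubs
turned into hypotheses and NO existence input: orders 0 and 1 are exact at every mesh (`stub_entire`, exact centring
`smearedCentring`), the coefficient limits at orders 2 and 3 exist and are identified by
`so_iteratedDeriv_two_eq_ofReal_integral` + `so_secondOrder_of_twoPoint` / `ho_iteratedDeriv_three_eq` +
`ho_thirdOrder_of_threePoint`, orders `≥ 4` are `FourUpT`, coefficientwise convergence of the normal family
(`stub_normalFamily`) is convergence (`stub_taylorLimit`), and at the real coupling `t = 1` real parts and
`Theorems.integral_site_eq` give the crux.  No named fact is used by the glue; no definition is introduced.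
-/

noncomputable section

namespace Summit.CriticalPhenomena.CardyFormulaZ2.Cruxes.MagicFormulaT.Split

open MeasureTheory Filter Set
open scoped Real Topology BigOperators ENNReal
open Literature.Probability.RandomPlanarGeometry Literature.Probability.Percolation
  Literature.Probability.LatticeModels
open Summit.CriticalPhenomena.CardyFormulaZ2.Cruxes.MagicFormulaT.LineSketch
open Summit.CriticalPhenomena.CardyFormulaZ2.Theorems

/-! ## An abstract composition: graded coefficient identification of a normal family ⇒ convergence -/

/-- If `F δ` is entire eventually, bounded on closed balls eventually, `F δ 0 = 1` and `(F δ)'(0) = 0` eventually,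
and the Taylor coefficients of orders `2`, `3` and `≥ 4` at `0` converge to those of `t ↦ exp(c t²)`, then
`F δ t → exp(c t²)` for every `t ∈ ℂ` (`stub_taylorLimit`). -/
theorem spl_tendsto_of_graded (F : ℝ → ℂ → ℂ) (c : ℂ)
    (hdiff : ∀ᶠ δ in 𝓝[>] (0 : ℝ), Differentiable ℂ (F δ))
    (hnormal : ∀ ρ : ℝ, 0 < ρ → ∃ M : ℝ, ∀ᶠ δ in 𝓝[>] (0 : ℝ), ∀ t : ℂ, ‖t‖ ≤ ρ → ‖F δ t‖ ≤ M)
    (h0 : ∀ᶠ δ in 𝓝[>] (0 : ℝ), F δ 0 = 1)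
    (h1 : ∀ᶠ δ in 𝓝[>] (0 : ℝ), deriv (F δ) 0 = 0)
    (h2 : Tendsto (fun δ ↦ iteratedDeriv 2 (F δ) 0) (𝓝[>] (0 : ℝ))
      (𝓝 (iteratedDeriv 2 (fun t : ℂ ↦ Complex.exp (c * t ^ 2)) 0)))
    (h3 : Tendsto (fun δ ↦ iteratedDeriv 3 (F δ) 0) (𝓝[>] (0 : ℝ))
      (𝓝 (iteratedDeriv 3 (fun t : ℂ ↦ Complex.exp (c * t ^ 2)) 0)))
    (h4 : ∀ k : ℕ, 4 ≤ k → Tendsto (fun δ ↦ iteratedDeriv k (F δ) 0) (𝓝[>] (0 : ℝ))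
      (𝓝 (iteratedDeriv k (fun t : ℂ ↦ Complex.exp (c * t ^ 2)) 0))) :
    ∀ t : ℂ, Tendsto (fun δ ↦ F δ t) (𝓝[>] (0 : ℝ)) (𝓝 (Complex.exp (c * t ^ 2))) := by
  have hG : Differentiable ℂ (fun t : ℂ ↦ Complex.exp (c * t ^ 2)) := by fun_prop
  have hall : ∀ k : ℕ, Tendsto (fun δ ↦ iteratedDeriv k (F δ) 0) (𝓝[>] (0 : ℝ))
      (𝓝 (iteratedDeriv k (fun t : ℂ ↦ Complex.exp (c * t ^ 2)) 0)) := by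
    intro k
    match k with
    | 0 =>
        have hG0 : iteratedDeriv 0 (fun t : ℂ ↦ Complex.exp (c * t ^ 2)) 0 = 1 := by simp
        rw [hG0]
        simp only [iteratedDeriv_zero]
        exact (tendsto_const_nhds (x := (1 : ℂ))).congr' (by
          filter_upwards [h0] with δ hδ using hδ.symm)
    | 1 =>
        simp only [iteratedDeriv_one, cfi_deriv_cexp_mul_sq_zero]
        exact (tendsto_const_nhds (x := (0 : ℂ))).congr' (by
          filter_upwards [h1] with δ hδ using hδ.symm)
    | 2 => exact h2
    | 3 => exact h3
    | k + 4 => exact h4 (k + 4) (by omega)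
  intro t
  exact stub_taylorLimit F (fun t : ℂ ↦ Complex.exp (c * t ^ 2)) hdiff hG hnormal hall t

/-! ## The published inputs settle the existence sub-crux -/

/-- **`CoeffLimitsExistT` modulo the published inputs.**  Camia–Newman's full-plane CLE₆ limit and Smirnov–Werner's
four-arm exponent give, through line `Sketch` v7.1's existence theorem `existsLimitT_of_facts`, the limit of
`Φ_δ(t)` at every REAL coupling `t`; the family is entire (`stub_entire`) and normal (`stub_normalFamily`), so by
`stub_vitaliCoeff` every Taylor coefficient at `0` converges.  (Statement in the route's vocabulary.) -/
theorem coeffLimitsExistT_of_facts : exists_isFullPlaneCNLLaw → SmirnovWerner2001_fourArm_scalingLimit →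
    ∀ (f : ℂ → ℝ) (R C : ℝ), Measurable f → (∀ z, |f z| ≤ C) → (∀ z, R < ‖z‖ → f z = 0) → ∫ z, f z = 0 →
    ∀ k : ℕ, ∃ a : ℂ, Tendsto (fun δ : ℝ ↦ iteratedDeriv k (fun t : ℂ ↦ ∫ cfg, (∏ᶠ u ∈
      {u : UnbasedLoop ℂ | ∃ (v : HexVertex) (γ : hexGraph.Walk v v), IsSiteInterfaceLoop cfg γ ∧
        u = UnbasedLoop.mk (BasedLoop.mk (siteLoopCurve δ γ) (isLoop_siteLoopCurve δ γ))},
      2 * Complex.cos (t * ((∫ z in {z : ℂ | u.wind z ≠ 0}, f z : ℝ) : ℂ) + (Real.pi : ℂ) / 3))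
        ∂(triSitePercolation half)) 0) (𝓝[>] (0 : ℝ)) (𝓝 a) := by
  intro hCN hSW f R C hf hC hR h0
  simp_rw [← loops_siteLoopConfig]
  have hpos : ∀ᶠ δ in 𝓝[>] (0 : ℝ), 0 < δ := self_mem_nhdsWithin
  have hdiff : ∀ᶠ δ in 𝓝[>] (0 : ℝ), Differentiable ℂ (fun t : ℂ ↦ ∫ ω, (∏ᶠ u ∈ (siteLoopConfig δ ω).loops,
      2 * Complex.cos (t * ((u.nestingPhase f : ℝ) : ℂ) + (Real.pi : ℂ) / 3)) ∂(triSitePercolation half)) := by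
    filter_upwards [hpos] with δ hδ using (stub_entire f R C hf hC hR h0 δ hδ).1
  have hreal : ∀ t : ℝ, ∃ L : ℂ, Tendsto (fun δ ↦ (fun t : ℂ ↦ ∫ ω, (∏ᶠ u ∈ (siteLoopConfig δ ω).loops,
      2 * Complex.cos (t * ((u.nestingPhase f : ℝ) : ℂ) + (Real.pi : ℂ) / 3)) ∂(triSitePercolation half)) (t : ℂ))
      (𝓝[>] (0 : ℝ)) (𝓝 L) := by
    intro t
    have hm : Measurable (fun z ↦ t * f z) := hf.const_mul t
    have hb : ∀ z, |t * f z| ≤ |t| * C := fun z ↦ by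
      rw [abs_mul]; exact mul_le_mul_of_nonneg_left (hC z) (abs_nonneg t)
    have hs : ∀ z, R < ‖z‖ → t * f z = 0 := fun z hz ↦ by rw [hR z hz, mul_zero]
    have hi : ∫ z, t * f z = 0 := by rw [integral_const_mul, h0, mul_zero]
    obtain ⟨L, hL⟩ := existsLimitT_of_facts hCN hSW (fun z ↦ t * f z) R (|t| * C) hm hb hs hi
    refine ⟨(L : ℂ), ((Complex.continuous_ofReal.tendsto L).comp hL).congr' ?_⟩
    filter_upwards [hpos] with δ hδ
    exact ((stub_entire f R C hf hC hR h0 δ hδ).2.2.2 t).symm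
  exact stub_vitaliCoeff _ hdiff (stub_normalFamily f R C hf hC hR h0) hreal

/-! ## The route item `FourUpT` from the skeleton's identification stub, modulo the published inputs -/

/-- **`FourUpT` = identification + existence.**  Given the published inputs (hence `coeffLimitsExistT_of_facts`)
and the skeleton's identification stub `stub_fourUp` (orders `≥ 4`: every limit of `Φ_δ^{(k)}(0)` is the Gaussian
Taylor coefficient), the outright-convergence route item `FourUpT` follows.  (Statements in the route's vocabulary;
this is how line `Sketch` closes the route item once `stub_fourUp` lands.) -/
theorem fourUpT_of_facts_of_identification : exists_isFullPlaneCNLLaw → SmirnovWerner2001_fourArm_scalingLimit →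
    (∀ (f : ℂ → ℝ) (R C : ℝ), Measurable f → (∀ z, |f z| ≤ C) → (∀ z, R < ‖z‖ → f z = 0) → ∫ z, f z = 0 →
      ∀ k : ℕ, 4 ≤ k → ∀ a : ℂ, Tendsto (fun δ : ℝ ↦ iteratedDeriv k (fun t : ℂ ↦ ∫ cfg, (∏ᶠ u ∈
        {u : UnbasedLoop ℂ | ∃ (v : HexVertex) (γ : hexGraph.Walk v v), IsSiteInterfaceLoop cfg γ ∧
          u = UnbasedLoop.mk (BasedLoop.mk (siteLoopCurve δ γ) (isLoop_siteLoopCurve δ γ))},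
        2 * Complex.cos (t * ((∫ z in {z : ℂ | u.wind z ≠ 0}, f z : ℝ) : ℂ) + (Real.pi : ℂ) / 3))
          ∂(triSitePercolation half)) 0) (𝓝[>] (0 : ℝ)) (𝓝 a) →
      a = iteratedDeriv k (fun t : ℂ ↦ Complex.exp
        (((3 / (4 * Real.pi ^ 2) * ∫ x, ∫ y, Real.log ‖x - y‖ * f x * f y : ℝ) : ℂ) * t ^ 2)) 0) →
    (∀ (f : ℂ → ℝ) (R C : ℝ), Measurable f → (∀ z, |f z| ≤ C) → (∀ z, R < ‖z‖ → f z = 0) → ∫ z, f z = 0 →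
      ∀ k : ℕ, 4 ≤ k → Tendsto (fun δ : ℝ ↦ iteratedDeriv k (fun t : ℂ ↦ ∫ cfg, (∏ᶠ u ∈
        {u : UnbasedLoop ℂ | ∃ (v : HexVertex) (γ : hexGraph.Walk v v), IsSiteInterfaceLoop cfg γ ∧
          u = UnbasedLoop.mk (BasedLoop.mk (siteLoopCurve δ γ) (isLoop_siteLoopCurve δ γ))},
        2 * Complex.cos (t * ((∫ z in {z : ℂ | u.wind z ≠ 0}, f z : ℝ) : ℂ) + (Real.pi : ℂ) / 3))
          ∂(triSitePercolation half)) 0) (𝓝[>] (0 : ℝ))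
        (𝓝 (iteratedDeriv k (fun t : ℂ ↦ Complex.exp
          (((3 / (4 * Real.pi ^ 2) * ∫ x, ∫ y, Real.log ‖x - y‖ * f x * f y : ℝ) : ℂ) * t ^ 2)) 0))) := by
  intro hCN hSW hid f R C hf hC hR h0 k hk
  obtain ⟨a, ha⟩ := coeffLimitsExistT_of_facts hCN hSW f R C hf hC hR h0 k
  have key := hid f R C hf hC hR h0 k hk a ha
  rw [key] at ha
  exact ha

/-! ## The split glue -/

/-- **Route-level split of the crux (strategist s4): `TwoPointT → ThreePointT → FourUpT → MagicFormulaT`.**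
Hypotheses, in order: the order-2 power-sum limit `E[3A₁² − 4A₂] → (3/2π²)∬ f f log‖x−y‖`; the order-3 power-sum
limit `E[3A₁³ − 12A₁A₂ + 8A₃] → 0`; convergence of every Taylor coefficient of order `≥ 4` of the complex-coupling
transform `Φ_δ(t) = E_{1/2}[∏_u 2cos(t θ_u(f) + π/3)]` to the Taylor coefficient of `exp(q(f) t²)`.  Conclusion: the
crux, by name.  Proof = the composition of skeleton `Lines/Sketch.lean` v9 with its stubs as hypotheses and no
existence input: orders 0/1 exact at every mesh (`stub_entire`, `smearedCentring`), orders 2/3 exist and are identified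
(`so_iteratedDeriv_two_eq_ofReal_integral` + `so_secondOrder_of_twoPoint`, `ho_iteratedDeriv_three_eq` +
`ho_thirdOrder_of_threePoint`), `≥ 4` by hypothesis, then `stub_taylorLimit` at `t = 1` on the normal family
(`stub_normalFamily`), real parts, `Theorems.integral_site_eq`. -/
theorem MagicFormulaT_of_subs :
    (∀ (f : ℂ → ℝ) (R C : ℝ), Measurable f → (∀ z, |f z| ≤ C) → (∀ z, R < ‖z‖ → f z = 0) → ∫ z, f z = 0 →
      Tendsto (fun δ : ℝ ↦ ∫ cfg, (3 * (∑ᶠ u ∈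
        {u : UnbasedLoop ℂ | ∃ (v : HexVertex) (γ : hexGraph.Walk v v), IsSiteInterfaceLoop cfg γ ∧
          u = UnbasedLoop.mk (BasedLoop.mk (siteLoopCurve δ γ) (isLoop_siteLoopCurve δ γ))},
          ∫ z in {z : ℂ | u.wind z ≠ 0}, f z) ^ 2 -
        4 * (∑ᶠ u ∈
        {u : UnbasedLoop ℂ | ∃ (v : HexVertex) (γ : hexGraph.Walk v v), IsSiteInterfaceLoop cfg γ ∧
          u = UnbasedLoop.mk (BasedLoop.mk (siteLoopCurve δ γ) (isLoop_siteLoopCurve δ γ))},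
          (∫ z in {z : ℂ | u.wind z ≠ 0}, f z) ^ 2)) ∂(triSitePercolation half))
        (𝓝[>] (0 : ℝ)) (𝓝 (3 / (2 * Real.pi ^ 2) * ∫ x, ∫ y, Real.log ‖x - y‖ * f x * f y))) →
    (∀ (f : ℂ → ℝ) (R C : ℝ), Measurable f → (∀ z, |f z| ≤ C) → (∀ z, R < ‖z‖ → f z = 0) → ∫ z, f z = 0 →
      Tendsto (fun δ : ℝ ↦ ∫ cfg, (3 * (∑ᶠ u ∈
        {u : UnbasedLoop ℂ | ∃ (v : HexVertex) (γ : hexGraph.Walk v v), IsSiteInterfaceLoop cfg γ ∧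
          u = UnbasedLoop.mk (BasedLoop.mk (siteLoopCurve δ γ) (isLoop_siteLoopCurve δ γ))},
          ∫ z in {z : ℂ | u.wind z ≠ 0}, f z) ^ 3 -
        12 * (∑ᶠ u ∈
        {u : UnbasedLoop ℂ | ∃ (v : HexVertex) (γ : hexGraph.Walk v v), IsSiteInterfaceLoop cfg γ ∧
          u = UnbasedLoop.mk (BasedLoop.mk (siteLoopCurve δ γ) (isLoop_siteLoopCurve δ γ))},
          ∫ z in {z : ℂ | u.wind z ≠ 0}, f z) *
          (∑ᶠ u ∈
        {u : UnbasedLoop ℂ | ∃ (v : HexVertex) (γ : hexGraph.Walk v v), IsSiteInterfaceLoop cfg γ ∧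
          u = UnbasedLoop.mk (BasedLoop.mk (siteLoopCurve δ γ) (isLoop_siteLoopCurve δ γ))},
          (∫ z in {z : ℂ | u.wind z ≠ 0}, f z) ^ 2) +
        8 * (∑ᶠ u ∈
        {u : UnbasedLoop ℂ | ∃ (v : HexVertex) (γ : hexGraph.Walk v v), IsSiteInterfaceLoop cfg γ ∧
          u = UnbasedLoop.mk (BasedLoop.mk (siteLoopCurve δ γ) (isLoop_siteLoopCurve δ γ))},
          (∫ z in {z : ℂ | u.wind z ≠ 0}, f z) ^ 3)) ∂(triSitePercolation half))
        (𝓝[>] (0 : ℝ)) (𝓝 0)) →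
    (∀ (f : ℂ → ℝ) (R C : ℝ), Measurable f → (∀ z, |f z| ≤ C) → (∀ z, R < ‖z‖ → f z = 0) → ∫ z, f z = 0 →
      ∀ k : ℕ, 4 ≤ k → Tendsto (fun δ : ℝ ↦ iteratedDeriv k (fun t : ℂ ↦ ∫ cfg, (∏ᶠ u ∈
        {u : UnbasedLoop ℂ | ∃ (v : HexVertex) (γ : hexGraph.Walk v v), IsSiteInterfaceLoop cfg γ ∧
          u = UnbasedLoop.mk (BasedLoop.mk (siteLoopCurve δ γ) (isLoop_siteLoopCurve δ γ))},
        2 * Complex.cos (t * ((∫ z in {z : ℂ | u.wind z ≠ 0}, f z : ℝ) : ℂ) + (Real.pi : ℂ) / 3))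
          ∂(triSitePercolation half)) 0) (𝓝[>] (0 : ℝ))
        (𝓝 (iteratedDeriv k (fun t : ℂ ↦ Complex.exp
          (((3 / (4 * Real.pi ^ 2) * ∫ x, ∫ y, Real.log ‖x - y‖ * f x * f y : ℝ) : ℂ) * t ^ 2)) 0))) →
    Summit.CriticalPhenomena.CardyFormulaZ2.Theses.CardyMagicRigidity.MagicFormulaT := by
  intro h2 h3 h4 f R C hf hC hR h0
  -- pass to the vocabulary of line `Sketch`: the untyped interface-loop set is `(siteLoopConfig δ cfg).loops`
  -- (`loops_siteLoopConfig`) and `∫ z in {z | u.wind z ≠ 0}, f z = u.nestingPhase f` (by definition)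
  have h2f := h2 f R C hf hC hR h0
  have h3f := h3 f R C hf hC hR h0
  have h4f := h4 f R C hf hC hR h0
  clear h2 h3 h4
  simp_rw [← loops_siteLoopConfig] at h2f h3f h4f
  have hphase : ∀ u : UnbasedLoop ℂ, (∫ z in {z : ℂ | u.wind z ≠ 0}, f z) = u.nestingPhase f := fun u ↦ rfl
  simp_rw [hphase] at h2f h3f h4f
  -- the ingredients of the abstract composition
  have hpos : ∀ᶠ δ in 𝓝[>] (0 : ℝ), 0 < δ := self_mem_nhdsWithin
  have hdiff : ∀ᶠ δ in 𝓝[>] (0 : ℝ), Differentiable ℂ (fun t : ℂ ↦ ∫ ω, (∏ᶠ u ∈ (siteLoopConfig δ ω).loops,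
      2 * Complex.cos (t * ((u.nestingPhase f : ℝ) : ℂ) + (Real.pi : ℂ) / 3)) ∂(triSitePercolation half)) := by
    filter_upwards [hpos] with δ hδ using (stub_entire f R C hf hC hR h0 δ hδ).1
  have hzero : ∀ᶠ δ in 𝓝[>] (0 : ℝ), (fun t : ℂ ↦ ∫ ω, (∏ᶠ u ∈ (siteLoopConfig δ ω).loops,
      2 * Complex.cos (t * ((u.nestingPhase f : ℝ) : ℂ) + (Real.pi : ℂ) / 3)) ∂(triSitePercolation half)) 0 = 1 := by
    filter_upwards [hpos] with δ hδ using (stub_entire f R C hf hC hR h0 δ hδ).2.1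
  have hone : ∀ᶠ δ in 𝓝[>] (0 : ℝ), deriv (fun t : ℂ ↦ ∫ ω, (∏ᶠ u ∈ (siteLoopConfig δ ω).loops,
      2 * Complex.cos (t * ((u.nestingPhase f : ℝ) : ℂ) + (Real.pi : ℂ) / 3)) ∂(triSitePercolation half)) 0 = 0 := by
    filter_upwards [hpos] with δ hδ
    rw [(stub_entire f R C hf hC hR h0 δ hδ).2.2.1, smearedCentring half f R C δ hf hC hR h0 hδ]
    simp
  -- order 2: the coefficient limit EXISTS (it is `↑E[3A₁² − 4A₂]` at every positive mesh) and is identified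
  have htwo : Tendsto (fun δ : ℝ ↦ iteratedDeriv 2 (fun t : ℂ ↦ ∫ ω, (∏ᶠ u ∈ (siteLoopConfig δ ω).loops,
      2 * Complex.cos (t * ((u.nestingPhase f : ℝ) : ℂ) + (Real.pi : ℂ) / 3)) ∂(triSitePercolation half)) 0)
      (𝓝[>] (0 : ℝ)) (𝓝 (iteratedDeriv 2 (fun t : ℂ ↦ Complex.exp
        (((3 / (4 * π ^ 2) * ∫ x, ∫ y, Real.log ‖x - y‖ * f x * f y : ℝ) : ℂ) * t ^ 2)) 0)) := by
    have ha : Tendsto (fun δ : ℝ ↦ iteratedDeriv 2 (fun t : ℂ ↦ ∫ ω, (∏ᶠ u ∈ (siteLoopConfig δ ω).loops,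
        2 * Complex.cos (t * ((u.nestingPhase f : ℝ) : ℂ) + (Real.pi : ℂ) / 3)) ∂(triSitePercolation half)) 0)
        (𝓝[>] (0 : ℝ)) (𝓝 (((3 / (2 * π ^ 2) * ∫ x, ∫ y, Real.log ‖x - y‖ * f x * f y : ℝ) : ℂ))) := by
      refine Tendsto.congr' ?_ ((Complex.continuous_ofReal.tendsto _).comp h2f)
      filter_upwards [hpos] with δ hδ
      exact (so_iteratedDeriv_two_eq_ofReal_integral hf hC hR h0 hδ).symm
    have key := so_secondOrder_of_twoPoint f R C hf hC hR h0 h2f _ ha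
    rw [key] at ha
    exact ha
  -- order 3: likewise (the coefficient is `↑(−√3 · E[3A₁³ − 12A₁A₂ + 8A₃])` at every positive mesh)
  have hthree : Tendsto (fun δ : ℝ ↦ iteratedDeriv 3 (fun t : ℂ ↦ ∫ ω, (∏ᶠ u ∈ (siteLoopConfig δ ω).loops,
      2 * Complex.cos (t * ((u.nestingPhase f : ℝ) : ℂ) + (Real.pi : ℂ) / 3)) ∂(triSitePercolation half)) 0)
      (𝓝[>] (0 : ℝ)) (𝓝 (iteratedDeriv 3 (fun t : ℂ ↦ Complex.exp
        (((3 / (4 * π ^ 2) * ∫ x, ∫ y, Real.log ‖x - y‖ * f x * f y : ℝ) : ℂ) * t ^ 2)) 0)) := by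
    have ha : Tendsto (fun δ : ℝ ↦ iteratedDeriv 3 (fun t : ℂ ↦ ∫ ω, (∏ᶠ u ∈ (siteLoopConfig δ ω).loops,
        2 * Complex.cos (t * ((u.nestingPhase f : ℝ) : ℂ) + (Real.pi : ℂ) / 3)) ∂(triSitePercolation half)) 0)
        (𝓝[>] (0 : ℝ)) (𝓝 (((-Real.sqrt 3 * 0 : ℝ) : ℂ))) := by
      refine Tendsto.congr' ?_ ((Complex.continuous_ofReal.tendsto _).comp (h3f.const_mul (-Real.sqrt 3)))
      filter_upwards [hpos] with δ hδ
      exact (ho_iteratedDeriv_three_eq hf hC hR h0 hδ).symm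
    have key := ho_thirdOrder_of_threePoint f R C hf hC hR h0 h3f _ ha
    rw [key] at ha
    exact ha
  -- the normal family converges to the Gaussian at every coupling, in particular at `t = 1`
  have hlim := spl_tendsto_of_graded _ _ hdiff (stub_normalFamily f R C hf hC hR h0) hzero hone htwo hthree
    h4f 1
  -- back to the real transform at coupling `1`
  have hlim' : Tendsto (fun δ : ℝ ↦ ((truncNestingTransform (triSitePercolation half) (siteLoopConfig δ) f 0 :
      ℝ) : ℂ)) (𝓝[>] (0 : ℝ))
      (𝓝 (((Real.exp (3 / (4 * π ^ 2) * ∫ x, ∫ y, Real.log ‖x - y‖ * f x * f y)) : ℝ) : ℂ)) := by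
    have hG1 : Complex.exp (((3 / (4 * π ^ 2) * ∫ x, ∫ y, Real.log ‖x - y‖ * f x * f y : ℝ) : ℂ) * (1 : ℂ) ^ 2)
        = (((Real.exp (3 / (4 * π ^ 2) * ∫ x, ∫ y, Real.log ‖x - y‖ * f x * f y)) : ℝ) : ℂ) := by
      simp [Complex.ofReal_exp]
    rw [← hG1]
    refine hlim.congr' ?_
    filter_upwards [hpos] with δ hδ
    have h1 := (stub_entire f R C hf hC hR h0 δ hδ).2.2.2 1
    simp only [Complex.ofReal_one, one_mul] at h1
    simpa using h1
  have key := (Complex.continuous_re.tendsto _).comp hlim'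
  simp only [Function.comp_def, Complex.ofReal_re] at key
  exact key.congr' (Eventually.of_forall fun δ ↦ (Theorems.integral_site_eq f δ).symm)

end Summit.CriticalPhenomena.CardyFormulaZ2.Cruxes.MagicFormulaT.Split

end
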